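import Summits.Parity.GeneralizedHardyLittlewood.Theses.LiouvilleShiftedTables
import Summits.Parity.GeneralizedHardyLittlewood.Theses.RoughSemiprimeRigidity
import Literature.NumberTheory.Sieve.ElliottHalberstamBridgeProofs
import Summits.Parity.GeneralizedHardyLittlewood.Theorems.LiouvilleShiftedTablesEHStubLowConductor
import Summits.Parity.GeneralizedHardyLittlewood.Theorems.LiouvilleShiftedTablesEHStubReplication
import Summits.Parity.GeneralizedHardyLittlewood.Theorems.LiouvilleShiftedTablesEHStubBadModuliHarmonic
import Summits.Parity.GeneralizedHardyLittlewood.Theorems.LiouvilleShiftedTablesEHStubDescentLog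
import Summits.Parity.GeneralizedHardyLittlewood.Theorems.LiouvilleShiftedTablesEHPurityLogOfEH

/-!
# Localisation of the Elliott–Halberstam conjecture to one window (crux `EH`, stmt-Parity-11314)

Line `upward-replication-free-factorability`, log-sparse variant (lead c1): the kernel-checked
NORMAL FORM of the crux.  Write, at height `x`, conductor cut `D = ⌊x^{1/2−δ₀}⌋₊` and modulus `m`,
`E♯(x; m) = max_{a unit} ‖φ(m)⁻¹ ∑_{χ mod m, cond χ > D} χ(a⁻¹) ψ(x, χ)‖` (maximal conductor-excised
discrepancy).  *Log-sparse top-window purity* at window exponent `ε'` says: for all `B, B' > 0` there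
are `δ₀ ∈ (0, 1/2)` and `x₀` such that for `x ≥ x₀` all but `≤ x^{1−ε'}/(log x)^{B'}` moduli
`m ∈ (x^{1−ε'}, 2x^{1−ε'}]` have `E♯(x; m) < x/(φ(m)(log x)^B)`.

* `eh_iff_topWindowPurityLog`: the route decl `EH` (Elliott–Halberstam verbatim, both routes) is
  EQUIVALENT to log-sparse top-window purity for every `ε' ∈ (0, 1/2]`;
* `eh_below_iff_purityLog_below` (graded, `ϑ ≤ 1`): `EH θ` for every `θ < ϑ` (Wave0 form) iff
  log-sparse purity holds in every window `x^{1−ε'}` with `1 − ε' < ϑ`.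

So a proof of any new level of distribution `ϑ > 1/2` may restrict attention to the high-conductor
(`cond χ > x^{1/2−δ₀}`) part of the discrepancy, at the single height `x`, in single dyadic windows of
moduli below `x^ϑ`, and may discard `x^{1−ε'}/(log x)^{B'}` moduli per window.  The POWER-sparse
strengthening (exceptional set `≤ x^{1−ε'−η}`; registered stub `stub_topWindowPurity`, implied by a
`2k`-th moment bound, `stub_windowMoment`) is strictly stronger than what `EH` returns and is open
beyond every known method for `ε' ≤ 1/2`.

Ingredients (all landed): `LowConductor.stub_lowConductor` (Bombieri–Vinogradov technology with the
conductor capped, every level `θ < 1`), `Replication.stub_replication` (character theory),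
`BadModuliHarmonic.stub_badModuliHarmonic` (PNT + counting), `DescentLog.stub_descentLog(Graded)`
(bookkeeping), `PurityLogOfEH.purityLog_of_ehAt` (Markov), and the tree equivalence
`Literature.NumberTheory.Sieve.elliottHalberstam_iff_wave0_holds` (Iwaniec–Kowalski §17.1).

References: H. Davenport, *Multiplicative Number Theory*, ch. 28; H. Iwaniec, E. Kowalski,
*Analytic Number Theory*, §17.1; line card `Cruxes/EH/Lines/upward-replication-free-factorability.md`.
-/

namespace Summit.Parity.GeneralizedHardyLittlewood.Theorems.EH.Localisation

open Summit.Parity.GeneralizedHardyLittlewood.Theorems.EH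

/-- **Log-sparse top-window purity implies the Elliott–Halberstam conjecture** (route decl
`LiouvilleShiftedTables.EH`): the landed stubs `stub_lowConductor`, `stub_replication`,
`stub_badModuliHarmonic` fed into the landed descent `stub_descentLog`, then the tree equivalence
`elliottHalberstam_iff_wave0_holds`. [folklore] -/
theorem eh_of_topWindowPurityLog
    (hPurity : ∀ ε' : ℝ, 0 < ε' → ε' ≤ 1 / 2 → ∀ B : ℝ, 0 < B → ∀ B' : ℝ, 0 < B' →
      ∃ δ₀ : ℝ, 0 < δ₀ ∧ δ₀ < 1 / 2 ∧ ∃ x₀ : ℝ, ∀ x : ℝ, x₀ ≤ x →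
        ∃ I : Finset ℕ, (I.card : ℝ) ≤ x ^ (1 - ε') / Real.log x ^ B' ∧
          ∀ m ∈ Finset.Ioc ⌊x ^ (1 - ε')⌋₊ ⌊2 * x ^ (1 - ε')⌋₊, m ∉ I →
            (⨆ a : (ZMod m)ˣ,
                ‖((Nat.totient m : ℂ))⁻¹ *
                    ∑ χ ∈ (Finset.univ : Finset (DirichletCharacter ℂ m)) with
                        ⌊x ^ (1 / 2 - δ₀)⌋₊ < χ.conductor,
                      χ (a : ZMod m)⁻¹ * Literature.NumberTheory.Sieve.chebyshevPsiChar χ x‖) <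
              x / ((Nat.totient m : ℝ) * Real.log x ^ B)) :
    Summit.Parity.GeneralizedHardyLittlewood.Theses.LiouvilleShiftedTables.EH :=
  Literature.NumberTheory.Sieve.elliottHalberstam_iff_wave0_holds.mpr
    (DescentLog.stub_descentLog LowConductor.stub_lowConductor Replication.stub_replication hPurity
      BadModuliHarmonic.stub_badModuliHarmonic)

/-- **The Elliott–Halberstam conjecture implies log-sparse top-window purity** (every
`ε' ∈ (0, 1/2]`): the tree equivalence with the Wave0 form and `PurityLogOfEH.stub_topWindowPurityLog_of_eh`
(Markov + `stub_lowConductor`). [folklore] -/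
theorem topWindowPurityLog_of_eh
    (hEH : Summit.Parity.GeneralizedHardyLittlewood.Theses.LiouvilleShiftedTables.EH) :
    ∀ ε' : ℝ, 0 < ε' → ε' ≤ 1 / 2 → ∀ B : ℝ, 0 < B → ∀ B' : ℝ, 0 < B' →
      ∃ δ₀ : ℝ, 0 < δ₀ ∧ δ₀ < 1 / 2 ∧ ∃ x₀ : ℝ, ∀ x : ℝ, x₀ ≤ x →
        ∃ I : Finset ℕ, (I.card : ℝ) ≤ x ^ (1 - ε') / Real.log x ^ B' ∧
          ∀ m ∈ Finset.Ioc ⌊x ^ (1 - ε')⌋₊ ⌊2 * x ^ (1 - ε')⌋₊, m ∉ I →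
            (⨆ a : (ZMod m)ˣ,
                ‖((Nat.totient m : ℂ))⁻¹ *
                    ∑ χ ∈ (Finset.univ : Finset (DirichletCharacter ℂ m)) with
                        ⌊x ^ (1 / 2 - δ₀)⌋₊ < χ.conductor,
                      χ (a : ZMod m)⁻¹ * Literature.NumberTheory.Sieve.chebyshevPsiChar χ x‖) <
              x / ((Nat.totient m : ℝ) * Real.log x ^ B) :=
  PurityLogOfEH.stub_topWindowPurityLog_of_eh
    (Literature.NumberTheory.Sieve.elliottHalberstam_iff_wave0_holds.mp hEH)

/-- **Localisation normal form of the crux.** The route decl `EH` (the Elliott–Halberstam conjecture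
verbatim) is equivalent to log-sparse purity of the conductor-excised discrepancy in every single
window of moduli `(x^{1−ε'}, 2x^{1−ε'}]`, `0 < ε' ≤ 1/2`. [folklore] -/
theorem eh_iff_topWindowPurityLog :
    Summit.Parity.GeneralizedHardyLittlewood.Theses.LiouvilleShiftedTables.EH ↔
    ∀ ε' : ℝ, 0 < ε' → ε' ≤ 1 / 2 → ∀ B : ℝ, 0 < B → ∀ B' : ℝ, 0 < B' →
      ∃ δ₀ : ℝ, 0 < δ₀ ∧ δ₀ < 1 / 2 ∧ ∃ x₀ : ℝ, ∀ x : ℝ, x₀ ≤ x →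
        ∃ I : Finset ℕ, (I.card : ℝ) ≤ x ^ (1 - ε') / Real.log x ^ B' ∧
          ∀ m ∈ Finset.Ioc ⌊x ^ (1 - ε')⌋₊ ⌊2 * x ^ (1 - ε')⌋₊, m ∉ I →
            (⨆ a : (ZMod m)ˣ,
                ‖((Nat.totient m : ℂ))⁻¹ *
                    ∑ χ ∈ (Finset.univ : Finset (DirichletCharacter ℂ m)) with
                        ⌊x ^ (1 / 2 - δ₀)⌋₊ < χ.conductor,
                      χ (a : ZMod m)⁻¹ * Literature.NumberTheory.Sieve.chebyshevPsiChar χ x‖) <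
              x / ((Nat.totient m : ℝ) * Real.log x ^ B) :=
  ⟨topWindowPurityLog_of_eh, eh_of_topWindowPurityLog⟩

/-- The same equivalence for the second route's copy `RoughSemiprimeRigidity.EH` (byte-identical
body). [folklore] -/
theorem roughSemiprimeRigidity_eh_iff_topWindowPurityLog :
    Summit.Parity.GeneralizedHardyLittlewood.Theses.RoughSemiprimeRigidity.EH ↔
    ∀ ε' : ℝ, 0 < ε' → ε' ≤ 1 / 2 → ∀ B : ℝ, 0 < B → ∀ B' : ℝ, 0 < B' →
      ∃ δ₀ : ℝ, 0 < δ₀ ∧ δ₀ < 1 / 2 ∧ ∃ x₀ : ℝ, ∀ x : ℝ, x₀ ≤ x →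
        ∃ I : Finset ℕ, (I.card : ℝ) ≤ x ^ (1 - ε') / Real.log x ^ B' ∧
          ∀ m ∈ Finset.Ioc ⌊x ^ (1 - ε')⌋₊ ⌊2 * x ^ (1 - ε')⌋₊, m ∉ I →
            (⨆ a : (ZMod m)ˣ,
                ‖((Nat.totient m : ℂ))⁻¹ *
                    ∑ χ ∈ (Finset.univ : Finset (DirichletCharacter ℂ m)) with
                        ⌊x ^ (1 / 2 - δ₀)⌋₊ < χ.conductor,
                      χ (a : ZMod m)⁻¹ * Literature.NumberTheory.Sieve.chebyshevPsiChar χ x‖) <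
              x / ((Nat.totient m : ℝ) * Real.log x ^ B) :=
  eh_iff_topWindowPurityLog

/-- **Graded localisation.** For `ϑ ≤ 1`: the primes satisfy the Elliott–Halberstam estimate
`EH θ` (Wave0 form) at every level `θ < ϑ` iff log-sparse purity of the conductor-excised
discrepancy holds in every window `(x^{1−ε'}, 2x^{1−ε'}]` with `1 − ε' < ϑ`.  (`→`: Markov one level
up, `PurityLogOfEH.purityLog_of_ehAt` at `θ₀ = (1 − ε' + ϑ)/2`; `←`: the graded descent
`DescentLog.stub_descentLogGraded` at `ε' = (2 − ϑ − θ)/2`.)  At `ϑ = 1/2 + δ` this says: a level of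
distribution beyond `1/2` is exactly log-sparse purity of `Δ♯` in the windows just above `x^{1/2}`.
[folklore] -/
theorem eh_below_iff_purityLog_below (ϑ : ℝ) (hϑ : ϑ ≤ 1) :
    (∀ θ : ℝ, θ < ϑ → Literature.NumberTheory.Sieve.EH θ) ↔
    ∀ ε' : ℝ, 1 - ϑ < ε' → ∀ B : ℝ, 0 < B → ∀ B' : ℝ, 0 < B' →
      ∃ δ₀ : ℝ, 0 < δ₀ ∧ δ₀ < 1 / 2 ∧ ∃ x₀ : ℝ, ∀ x : ℝ, x₀ ≤ x →
        ∃ I : Finset ℕ, (I.card : ℝ) ≤ x ^ (1 - ε') / Real.log x ^ B' ∧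
          ∀ m ∈ Finset.Ioc ⌊x ^ (1 - ε')⌋₊ ⌊2 * x ^ (1 - ε')⌋₊, m ∉ I →
            (⨆ a : (ZMod m)ˣ,
                ‖((Nat.totient m : ℂ))⁻¹ *
                    ∑ χ ∈ (Finset.univ : Finset (DirichletCharacter ℂ m)) with
                        ⌊x ^ (1 / 2 - δ₀)⌋₊ < χ.conductor,
                      χ (a : ZMod m)⁻¹ * Literature.NumberTheory.Sieve.chebyshevPsiChar χ x‖) <
              x / ((Nat.totient m : ℝ) * Real.log x ^ B) := by
  constructor
  · intro h ε' hε' B _hB B' _hB'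
    refine ⟨1 / 4, by norm_num, by norm_num, ?_⟩
    exact PurityLogOfEH.purityLog_of_ehAt ε' ((1 - ε' + ϑ) / 2) (by linarith) (by linarith)
      (h _ (by linarith)) (1 / 4) (by norm_num) (by norm_num) B B'
  · intro h θ hθ
    have hε : 0 < (2 - ϑ - θ) / 2 := by linarith
    exact DescentLog.stub_descentLogGraded LowConductor.stub_lowConductor
      Replication.stub_replication BadModuliHarmonic.stub_badModuliHarmonic
      ((2 - ϑ - θ) / 2) hε (h _ (by linarith)) θ (by linarith)

end Summit.Parity.GeneralizedHardyLittlewood.Theorems.EH.Localisation
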